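import Summits.CriticalPhenomena.PercolationContinuityZ3.Theorems.Transplant.FKConnectivityAllQForestAdjacentDegThree
import HarnessLib

/-!
# The DEGREE-3 HUB MARGIN IDENTITY: at a vertex of degree 3 the square-free adjacent forest Rayleigh margin is EXACTLY
# `good − bad = 2·E_vy` — twice the number of colourings of the rest in which `v ~ y` and the third neighbour is separated from them

Support file (`--supports stmt-CriticalPhenomena-4575`), FK sub-lane `prim-bschramm-fk-1` (gen 24) of the post-continuity programme;
builds on p205010 (kernel theorem, internal audit signed; external expert review pending).  No definitions, no named facts, no sorries;
standard axioms.

`…ForestAdjacentDegThree` (fk-1 g18) proves the node's inequality `bad ≤ good` when `o` meets at most one pair `g = oz` of `M ∪ u₀` besides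
`e = ov`, `f = oy`.  This file sharpens the degree-3 case to an IDENTITY on the rest `(M₁, u₀) = (M ∖ {g}, u₀)`
(memo bschramm/FROM-fk-1-g24-HUB-EVENT-CALCULUS.md §1): with `N(S) := #_{(M₁,u₀)}(Fo ∩ {S pairwise separated}, Fo)` and
`E_p := #_{(M₁,u₀)}(Fo ∩ {p joined, the two other pairs of {v,y,z} separated}, Fo)`,
* **`hubThree_bad_good_eq`**: `bad = N(vyz) + N(vy)`, `good = N(vz) + #(Fo, Fo ∩ {y ↮ z})` (splitting by the side of `g`);
* **`fibreCount_sep_pair_split_vz / _yz / _vy`**: `N(vz) = N(vyz) + E_vy + E_yz`, `N(yz) = N(vyz) + E_vy + E_vz`, `N(vy) = N(vyz) + E_vz + E_yz`;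
* **`hubThree_margin_identity`**: **`good = bad + 2·E_vy`** — the base case (equality) of the conjecture HUB⁺ `good − bad ≥ 2E_vy` at hubs of
  every degree (memo §2; degree 4: `…ForestHubFourNode`), and a second proof of `adjForestNoSq_guarded_of_deg_le_three`'s degree-3 branch.
[cite: SempleWelsh2008, Conj. 1.1 (p. 2)] [cite: CibulkaHladkyLaCroixWagner2008, Thm. 1 (p. 2)] [cite: Linusson2011, Prop. 2.6] [cite: Grimmett2006, §1.5 (p. 13)]
-/

noncomputable section

namespace Summit.CriticalPhenomena.PercolationContinuityZ3.Theorems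
namespace FK

open MeasureTheory Set Literature.Probability.LatticeModels Literature.Probability.Percolation
open scoped Classical symmDiff

variable {V : Type*} [Fintype V]

/-! ### Three marked vertices: splitting "one pair separated" by the third vertex -/

section ThreeSplit

variable (N u : BondConfig V) (B : Set (BondConfig V)) (v y z : V)

/-- `#(Fo ∩ {v ↮ z}, B) = N(vyz) + E_vy + E_yz` (the cluster of `y` meets at most one of the separated `v, z`). [cite: Linusson2011, Prop. 2.6] -/
theorem fibreCount_sep_pair_split_vz :
    fibreCount N u (forestEv V ∩ {ω | ¬ (openGraph ω).Reachable v z}) B =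
      fibreCount N u (forestEv V ∩ {ω | ¬ (openGraph ω).Reachable v y ∧ ¬ (openGraph ω).Reachable v z ∧ ¬ (openGraph ω).Reachable y z}) B +
      fibreCount N u (forestEv V ∩ {ω | (openGraph ω).Reachable v y ∧ ¬ (openGraph ω).Reachable v z ∧ ¬ (openGraph ω).Reachable y z}) B +
      fibreCount N u (forestEv V ∩ {ω | (openGraph ω).Reachable y z ∧ ¬ (openGraph ω).Reachable v y ∧ ¬ (openGraph ω).Reachable v z}) B := by
  have hd1 : Disjoint (forestEv V ∩ {ω | ¬ (openGraph ω).Reachable v y ∧ ¬ (openGraph ω).Reachable v z ∧ ¬ (openGraph ω).Reachable y z})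
      (forestEv V ∩ {ω | (openGraph ω).Reachable v y ∧ ¬ (openGraph ω).Reachable v z ∧ ¬ (openGraph ω).Reachable y z}) :=
    Set.disjoint_left.2 fun ω h₁ h₂ => h₁.2.1 h₂.2.1
  have hd2 : Disjoint (forestEv V ∩ {ω | ¬ (openGraph ω).Reachable v y ∧ ¬ (openGraph ω).Reachable v z ∧ ¬ (openGraph ω).Reachable y z} ∪
      forestEv V ∩ {ω | (openGraph ω).Reachable v y ∧ ¬ (openGraph ω).Reachable v z ∧ ¬ (openGraph ω).Reachable y z})
      (forestEv V ∩ {ω | (openGraph ω).Reachable y z ∧ ¬ (openGraph ω).Reachable v y ∧ ¬ (openGraph ω).Reachable v z}) :=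
    Set.disjoint_left.2 fun ω h₁ h₂ => by rcases h₁ with h | h <;> exact h.2.2.2 h₂.2.1
  rw [← fibreCount_split_left N u B hd1, ← fibreCount_split_left N u B hd2]
  refine fibreCount_congr_fibre N u fun ω _ => ⟨fun ⟨⟨hF, h1⟩, hB⟩ => ⟨?_, hB⟩, fun ⟨hA, hB⟩ => ⟨?_, hB⟩⟩
  · by_cases hvy : (openGraph ω).Reachable v y
    · exact Or.inl (Or.inr ⟨hF, hvy, h1, fun h => h1 (hvy.trans h)⟩)
    · by_cases hyz : (openGraph ω).Reachable y z
      · exact Or.inr ⟨hF, hyz, hvy, h1⟩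
      · exact Or.inl (Or.inl ⟨hF, hvy, h1, hyz⟩)
  · rcases hA with (⟨hF, -, h1, -⟩ | ⟨hF, -, h1, -⟩) | ⟨hF, -, -, h1⟩ <;> exact ⟨hF, h1⟩

/-- `#(Fo ∩ {y ↮ z}, B) = N(vyz) + E_vy + E_vz`. [cite: Linusson2011, Prop. 2.6] -/
theorem fibreCount_sep_pair_split_yz :
    fibreCount N u (forestEv V ∩ {ω | ¬ (openGraph ω).Reachable y z}) B =
      fibreCount N u (forestEv V ∩ {ω | ¬ (openGraph ω).Reachable v y ∧ ¬ (openGraph ω).Reachable v z ∧ ¬ (openGraph ω).Reachable y z}) B +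
      fibreCount N u (forestEv V ∩ {ω | (openGraph ω).Reachable v y ∧ ¬ (openGraph ω).Reachable v z ∧ ¬ (openGraph ω).Reachable y z}) B +
      fibreCount N u (forestEv V ∩ {ω | (openGraph ω).Reachable v z ∧ ¬ (openGraph ω).Reachable v y ∧ ¬ (openGraph ω).Reachable y z}) B := by
  have hd1 : Disjoint (forestEv V ∩ {ω | ¬ (openGraph ω).Reachable v y ∧ ¬ (openGraph ω).Reachable v z ∧ ¬ (openGraph ω).Reachable y z})
      (forestEv V ∩ {ω | (openGraph ω).Reachable v y ∧ ¬ (openGraph ω).Reachable v z ∧ ¬ (openGraph ω).Reachable y z}) :=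
    Set.disjoint_left.2 fun ω h₁ h₂ => h₁.2.1 h₂.2.1
  have hd2 : Disjoint (forestEv V ∩ {ω | ¬ (openGraph ω).Reachable v y ∧ ¬ (openGraph ω).Reachable v z ∧ ¬ (openGraph ω).Reachable y z} ∪
      forestEv V ∩ {ω | (openGraph ω).Reachable v y ∧ ¬ (openGraph ω).Reachable v z ∧ ¬ (openGraph ω).Reachable y z})
      (forestEv V ∩ {ω | (openGraph ω).Reachable v z ∧ ¬ (openGraph ω).Reachable v y ∧ ¬ (openGraph ω).Reachable y z}) :=
    Set.disjoint_left.2 fun ω h₁ h₂ => by rcases h₁ with h | h <;> exact h.2.2.1 h₂.2.1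
  rw [← fibreCount_split_left N u B hd1, ← fibreCount_split_left N u B hd2]
  refine fibreCount_congr_fibre N u fun ω _ => ⟨fun ⟨⟨hF, h1⟩, hB⟩ => ⟨?_, hB⟩, fun ⟨hA, hB⟩ => ⟨?_, hB⟩⟩
  · by_cases hvy : (openGraph ω).Reachable v y
    · exact Or.inl (Or.inr ⟨hF, hvy, fun h => h1 (hvy.symm.trans h), h1⟩)
    · by_cases hvz : (openGraph ω).Reachable v z
      · exact Or.inr ⟨hF, hvz, hvy, h1⟩
      · exact Or.inl (Or.inl ⟨hF, hvy, hvz, h1⟩)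
  · rcases hA with (⟨hF, -, -, h1⟩ | ⟨hF, -, -, h1⟩) | ⟨hF, -, -, h1⟩ <;> exact ⟨hF, h1⟩

/-- `#(Fo ∩ {v ↮ y}, B) = N(vyz) + E_vz + E_yz`. [cite: Linusson2011, Prop. 2.6] -/
theorem fibreCount_sep_pair_split_vy :
    fibreCount N u (forestEv V ∩ {ω | ¬ (openGraph ω).Reachable v y}) B =
      fibreCount N u (forestEv V ∩ {ω | ¬ (openGraph ω).Reachable v y ∧ ¬ (openGraph ω).Reachable v z ∧ ¬ (openGraph ω).Reachable y z}) B +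
      fibreCount N u (forestEv V ∩ {ω | (openGraph ω).Reachable v z ∧ ¬ (openGraph ω).Reachable v y ∧ ¬ (openGraph ω).Reachable y z}) B +
      fibreCount N u (forestEv V ∩ {ω | (openGraph ω).Reachable y z ∧ ¬ (openGraph ω).Reachable v y ∧ ¬ (openGraph ω).Reachable v z}) B := by
  have hd1 : Disjoint (forestEv V ∩ {ω | ¬ (openGraph ω).Reachable v y ∧ ¬ (openGraph ω).Reachable v z ∧ ¬ (openGraph ω).Reachable y z})
      (forestEv V ∩ {ω | (openGraph ω).Reachable v z ∧ ¬ (openGraph ω).Reachable v y ∧ ¬ (openGraph ω).Reachable y z}) :=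
    Set.disjoint_left.2 fun ω h₁ h₂ => h₁.2.2.1 h₂.2.1
  have hd2 : Disjoint (forestEv V ∩ {ω | ¬ (openGraph ω).Reachable v y ∧ ¬ (openGraph ω).Reachable v z ∧ ¬ (openGraph ω).Reachable y z} ∪
      forestEv V ∩ {ω | (openGraph ω).Reachable v z ∧ ¬ (openGraph ω).Reachable v y ∧ ¬ (openGraph ω).Reachable y z})
      (forestEv V ∩ {ω | (openGraph ω).Reachable y z ∧ ¬ (openGraph ω).Reachable v y ∧ ¬ (openGraph ω).Reachable v z}) :=
    Set.disjoint_left.2 fun ω h₁ h₂ => by rcases h₁ with h | h <;> [exact h.2.2.2 h₂.2.1; exact h.2.2.2 h₂.2.1]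
  rw [← fibreCount_split_left N u B hd1, ← fibreCount_split_left N u B hd2]
  refine fibreCount_congr_fibre N u fun ω _ => ⟨fun ⟨⟨hF, h1⟩, hB⟩ => ⟨?_, hB⟩, fun ⟨hA, hB⟩ => ⟨?_, hB⟩⟩
  · by_cases hvz : (openGraph ω).Reachable v z
    · exact Or.inl (Or.inr ⟨hF, hvz, h1, fun h => h1 (hvz.trans h.symm)⟩)
    · by_cases hyz : (openGraph ω).Reachable y z
      · exact Or.inr ⟨hF, hyz, h1, hvz⟩
      · exact Or.inl (Or.inl ⟨hF, h1, hvz, hyz⟩)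
  · rcases hA with (⟨hF, h1, -, -⟩ | ⟨hF, -, h1, -⟩) | ⟨hF, -, h1, -⟩ <;> exact ⟨hF, h1⟩

end ThreeSplit

/-! ### The degree-3 hub: decomposition and the margin identity -/

section HubThree

variable {M u₀ : BondConfig V} {o v y z : V}

/-- **The degree-3 hub decomposition.**  Guarded fibre `(M, u₀)`, `e = ov`, `f = oy` outside `M ∪ u₀`, the only pair of `M ∪ u₀` at `o` is the
free pair `g = oz` (`o, v, y, z` distinct).  On the rest `M₁ = M ∖ {g}`:
`bad = N(vyz) + N(vy)` and `good = N(vz) + #(Fo, Fo ∩ {y ↮ z})`. [cite: SempleWelsh2008, Conj. 1.1 (p. 2)] [cite: Linusson2011, Prop. 2.6] -/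
theorem hubThree_bad_good_eq (hov : o ≠ v) (hoy : o ≠ y) (hvy : v ≠ y) (hoz : o ≠ z) (hvz : v ≠ z) (hyz : y ≠ z)
    (heM : s(o, v) ∉ M) (hfM : s(o, y) ∉ M) (heu : s(o, v) ∉ u₀) (hfu : s(o, y) ∉ u₀)
    (hgM : s(o, z) ∈ M) (hgu : s(o, z) ∉ u₀) (hdeg : ∀ p ∈ M ∪ u₀, o ∈ p → p = s(o, z)) :
    fibreCount M u₀ ({ω | s(o, v) ∉ ω ∧ s(o, y) ∉ ω} ∩ {ω | insert s(o, y) (insert s(o, v) ω) ∈ forestEv V})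
        ({ω | s(o, v) ∉ ω ∧ s(o, y) ∉ ω} ∩ forestEv V) =
      fibreCount (M \ {s(o, z)}) u₀
          (forestEv V ∩ {ω | ¬ (openGraph ω).Reachable v y ∧ ¬ (openGraph ω).Reachable v z ∧ ¬ (openGraph ω).Reachable y z}) (forestEv V) +
        fibreCount (M \ {s(o, z)}) u₀ (forestEv V ∩ {ω | ¬ (openGraph ω).Reachable v y}) (forestEv V) ∧
    fibreCount M u₀ ({ω | s(o, v) ∉ ω ∧ s(o, y) ∉ ω} ∩ {ω | insert s(o, v) ω ∈ forestEv V})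
        ({ω | s(o, v) ∉ ω ∧ s(o, y) ∉ ω} ∩ {ω | insert s(o, y) ω ∈ forestEv V}) =
      fibreCount (M \ {s(o, z)}) u₀ (forestEv V ∩ {ω | ¬ (openGraph ω).Reachable v z}) (forestEv V) +
        fibreCount (M \ {s(o, z)}) u₀ (forestEv V) (forestEv V ∩ {ω | ¬ (openGraph ω).Reachable y z}) := by
  set G : Set (BondConfig V) := {ω | s(o, v) ∉ ω ∧ s(o, y) ∉ ω} with hG
  set M₁ : BondConfig V := M \ {s(o, z)} with hM₁
  have hgM₁ : s(o, z) ∉ M₁ := fun h' => h'.2 rfl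
  have hM : M = insert s(o, z) M₁ := by rw [hM₁, insert_sdiff_singleton, insert_eq_of_mem hgM]
  have hsub₁ : M₁ ∪ u₀ ⊆ M ∪ u₀ := union_subset_union_left _ sdiff_subset
  have hgMu : s(o, z) ∉ M₁ ∪ u₀ := fun h' => h'.elim hgM₁ hgu
  have heg : s(o, v) ≠ s(o, z) := fun h' => hvz (Sym2.congr_right.1 h')
  have hfg : s(o, y) ≠ s(o, z) := fun h' => hyz (Sym2.congr_right.1 h')
  have hGsub : ∀ W : BondConfig V, W ⊆ M ∪ u₀ → W ∈ G := fun W hW =>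
    ⟨fun he => (hW he).elim heM heu, fun hf => (hW hf).elim hfM hfu⟩
  have facts : ∀ ω : BondConfig V, ω \ M₁ = u₀ →
      (∀ p ∈ ω, o ∉ p) ∧ (∀ p ∈ ω ∆ M₁, o ∉ p) ∧ s(o, z) ∉ ω ∧ s(o, z) ∉ ω ∆ M₁ ∧
        (∀ W : BondConfig V, W ⊆ insert s(o, z) ω → W ∈ G) ∧ (∀ W : BondConfig V, W ⊆ insert s(o, z) (ω ∆ M₁) → W ∈ G) := by
    intro ω hω
    have h := subset_union_of_fibre hω
    refine ⟨isolated_of_subset hdeg (h.1.trans hsub₁) (fun h' => hgMu (h.1 h')),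
      isolated_of_subset hdeg (h.2.trans hsub₁) (fun h' => hgMu (h.2 h')), fun h' => hgMu (h.1 h'), fun h' => hgMu (h.2 h'),
      fun W hW => hGsub W (hW.trans (insert_subset (Or.inl hgM) (h.1.trans hsub₁))),
      fun W hW => hGsub W (hW.trans (insert_subset (Or.inl hgM) (h.2.trans hsub₁)))⟩
  refine ⟨?_, ?_⟩
  · rw [hM, fibreCount_insert_one hgM₁]
    have e1 : fibreCount M₁ u₀ ({ω | s(o, z) ∉ ω} ∩ {ω | insert s(o, z) ω ∈ G ∩ {ω | insert s(o, y) (insert s(o, v) ω) ∈ forestEv V}})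
        ({ω | s(o, z) ∉ ω} ∩ (G ∩ forestEv V)) =
        fibreCount M₁ u₀
          (forestEv V ∩ {ω | ¬ (openGraph ω).Reachable v y ∧ ¬ (openGraph ω).Reachable v z ∧ ¬ (openGraph ω).Reachable y z})
          (forestEv V) := by
      refine fibreCount_congr_fibre M₁ u₀ fun ω hω => ?_
      obtain ⟨iso, isoB, hg, hgB, hGi, hGiB⟩ := facts ω hω
      have crit := isForestCfg_insert_three_of_isolated iso hov hoy hoz hvy hvz hyz
      constructor
      · rintro ⟨⟨-, -, hF⟩, ⟨-, -, hFB⟩⟩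
        exact ⟨⟨(crit.1 hF).1, (crit.1 hF).2⟩, hFB⟩
      · rintro ⟨⟨hF, hs⟩, hFB⟩
        exact ⟨⟨hg, hGi _ subset_rfl, crit.2 ⟨hF, hs⟩⟩, ⟨hgB, hGiB _ (subset_insert _ _), hFB⟩⟩
    have e2 : fibreCount M₁ u₀ ({ω | s(o, z) ∉ ω} ∩ (G ∩ {ω | insert s(o, y) (insert s(o, v) ω) ∈ forestEv V}))
        ({ω | s(o, z) ∉ ω} ∩ {ω | insert s(o, z) ω ∈ G ∩ forestEv V}) =
        fibreCount M₁ u₀ (forestEv V ∩ {ω | ¬ (openGraph ω).Reachable v y}) (forestEv V) := by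
      refine fibreCount_congr_fibre M₁ u₀ fun ω hω => ?_
      obtain ⟨iso, isoB, hg, hgB, hGi, hGiB⟩ := facts ω hω
      have crit := isForestCfg_insert_two_of_isolated iso hov hoy hvy
      have critB := isForestCfg_insert_of_isolated isoB hoz
      constructor
      · rintro ⟨⟨-, -, hF⟩, ⟨-, -, hFB⟩⟩
        exact ⟨⟨(crit.1 hF).1, (crit.1 hF).2⟩, critB.1 hFB⟩
      · rintro ⟨⟨hF, hs⟩, hFB⟩
        exact ⟨⟨hg, hGi _ (subset_insert _ _), crit.2 ⟨hF, hs⟩⟩, ⟨hgB, hGiB _ subset_rfl, critB.2 hFB⟩⟩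
    rw [e1, e2]
  · rw [hM, fibreCount_insert_one hgM₁]
    have e1 : fibreCount M₁ u₀ ({ω | s(o, z) ∉ ω} ∩ {ω | insert s(o, z) ω ∈ G ∩ {ω | insert s(o, v) ω ∈ forestEv V}})
        ({ω | s(o, z) ∉ ω} ∩ (G ∩ {ω | insert s(o, y) ω ∈ forestEv V})) =
        fibreCount M₁ u₀ (forestEv V ∩ {ω | ¬ (openGraph ω).Reachable v z}) (forestEv V) := by
      refine fibreCount_congr_fibre M₁ u₀ fun ω hω => ?_
      obtain ⟨iso, isoB, hg, hgB, hGi, hGiB⟩ := facts ω hω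
      have crit := isForestCfg_insert_two_of_isolated iso hoz hov hvz.symm
      have critB := isForestCfg_insert_of_isolated isoB hoy
      constructor
      · rintro ⟨⟨-, -, hF⟩, ⟨-, -, hFB⟩⟩
        exact ⟨⟨(crit.1 hF).1, fun h => (crit.1 hF).2 h.symm⟩, critB.1 hFB⟩
      · rintro ⟨⟨hF, hs⟩, hFB⟩
        exact ⟨⟨hg, hGi _ subset_rfl, crit.2 ⟨hF, fun h => hs h.symm⟩⟩, ⟨hgB, hGiB _ (subset_insert _ _), critB.2 hFB⟩⟩
    have e2 : fibreCount M₁ u₀ ({ω | s(o, z) ∉ ω} ∩ (G ∩ {ω | insert s(o, v) ω ∈ forestEv V}))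
        ({ω | s(o, z) ∉ ω} ∩ {ω | insert s(o, z) ω ∈ G ∩ {ω | insert s(o, y) ω ∈ forestEv V}}) =
        fibreCount M₁ u₀ (forestEv V) (forestEv V ∩ {ω | ¬ (openGraph ω).Reachable y z}) := by
      refine fibreCount_congr_fibre M₁ u₀ fun ω hω => ?_
      obtain ⟨iso, isoB, hg, hgB, hGi, hGiB⟩ := facts ω hω
      have crit := isForestCfg_insert_of_isolated iso hov
      have critB := isForestCfg_insert_two_of_isolated isoB hoz hoy hyz.symm
      constructor
      · rintro ⟨⟨-, -, hF⟩, ⟨-, -, hFB⟩⟩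
        exact ⟨crit.1 hF, (critB.1 hFB).1, fun h => (critB.1 hFB).2 h.symm⟩
      · rintro ⟨hF, hFB, hsB⟩
        exact ⟨⟨hg, hGi _ (subset_insert _ _), crit.2 hF⟩, ⟨hgB, hGiB _ subset_rfl, critB.2 ⟨hFB, fun h => hsB h.symm⟩⟩⟩
    rw [e1, e2]

/-- **THE DEGREE-3 HUB MARGIN IDENTITY: `good = bad + 2·E_vy`**, `E_vy = #_{(M ∖ {oz}, u₀)}(Fo ∩ {v ~ y, v ↮ z, y ↮ z}, Fo)` — at a vertex of
degree 3 the square-free adjacent forest Rayleigh margin is exactly twice the number of colourings of the rest joining `v, y` away from `z`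
(the equality case of conjecture HUB⁺; memo bschramm/FROM-fk-1-g24-HUB-EVENT-CALCULUS.md §1–2).
[cite: SempleWelsh2008, Conj. 1.1 (p. 2)] [cite: CibulkaHladkyLaCroixWagner2008, Thm. 1 (p. 2)] [cite: Linusson2011, Prop. 2.6] -/
theorem hubThree_margin_identity (hov : o ≠ v) (hoy : o ≠ y) (hvy : v ≠ y) (hoz : o ≠ z) (hvz : v ≠ z) (hyz : y ≠ z)
    (heM : s(o, v) ∉ M) (hfM : s(o, y) ∉ M) (heu : s(o, v) ∉ u₀) (hfu : s(o, y) ∉ u₀)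
    (hgM : s(o, z) ∈ M) (hgu : s(o, z) ∉ u₀) (hdeg : ∀ p ∈ M ∪ u₀, o ∈ p → p = s(o, z)) :
    fibreCount M u₀ ({ω | s(o, v) ∉ ω ∧ s(o, y) ∉ ω} ∩ {ω | insert s(o, v) ω ∈ forestEv V})
        ({ω | s(o, v) ∉ ω ∧ s(o, y) ∉ ω} ∩ {ω | insert s(o, y) ω ∈ forestEv V}) =
      fibreCount M u₀ ({ω | s(o, v) ∉ ω ∧ s(o, y) ∉ ω} ∩ {ω | insert s(o, y) (insert s(o, v) ω) ∈ forestEv V})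
        ({ω | s(o, v) ∉ ω ∧ s(o, y) ∉ ω} ∩ forestEv V) +
      2 * fibreCount (M \ {s(o, z)}) u₀
          (forestEv V ∩ {ω | (openGraph ω).Reachable v y ∧ ¬ (openGraph ω).Reachable v z ∧ ¬ (openGraph ω).Reachable y z}) (forestEv V) := by
  obtain ⟨hb, hg⟩ := hubThree_bad_good_eq hov hoy hvy hoz hvz hyz heM hfM heu hfu hgM hgu hdeg
  rw [hb, hg, fibreCount_swap (M \ {s(o, z)}) u₀ (forestEv V) (forestEv V ∩ {ω | ¬ (openGraph ω).Reachable y z}),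
    fibreCount_sep_pair_split_vz, fibreCount_sep_pair_split_yz, fibreCount_sep_pair_split_vy]
  ring

/-- The margin identity at the node level: on the split fibre `(M ∪ {e,f}, u₀)` at a degree-3 hub,
`#(Fo ∩ {e ∈ ω}, Fo ∩ {f ∈ ω}) = #(Fo ∩ {e,f ∈ ω}, Fo) + 2·E_vy`. [cite: SempleWelsh2008, Conj. 1.1 (p. 2)] [cite: Linusson2011, Prop. 2.6] -/
theorem adjForestNoSq_fibre_margin_deg_three (hov : o ≠ v) (hoy : o ≠ y) (hvy : v ≠ y) (hoz : o ≠ z) (hvz : v ≠ z) (hyz : y ≠ z)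
    (heM : s(o, v) ∉ M) (hfM : s(o, y) ∉ M) (heu : s(o, v) ∉ u₀) (hfu : s(o, y) ∉ u₀)
    (hgM : s(o, z) ∈ M) (hgu : s(o, z) ∉ u₀) (hdeg : ∀ p ∈ M ∪ u₀, o ∈ p → p = s(o, z)) :
    fibreCount (insert s(o, y) (insert s(o, v) M)) u₀ (forestEv V ∩ {ω | s(o, v) ∈ ω}) (forestEv V ∩ {ω | s(o, y) ∈ ω}) =
      fibreCount (insert s(o, y) (insert s(o, v) M)) u₀ (forestEv V ∩ {ω | s(o, v) ∈ ω ∧ s(o, y) ∈ ω}) (forestEv V) +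
      2 * fibreCount (M \ {s(o, z)}) u₀
          (forestEv V ∩ {ω | (openGraph ω).Reachable v y ∧ ¬ (openGraph ω).Reachable v z ∧ ¬ (openGraph ω).Reachable y z}) (forestEv V) := by
  have hef : s(o, v) ≠ s(o, y) := fun h' => hvy (Sym2.congr_right.1 h')
  rw [fibreCount_insert_two_both heM hfM, fibreCount_insert_two_one hef heM hfM]
  exact hubThree_margin_identity hov hoy hvy hoz hvz hyz heM hfM heu hfu hgM hgu hdeg

end HubThree

end FK
end Summit.CriticalPhenomena.PercolationContinuityZ3.Theorems

end
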